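import Summits.Schanuel.Schanuel.Theorems.RootDecomp1BMovingZeroFree01

/-!
# RootDecomp1BMovingZeroFree — lens 4, generation 42 «LEVEL-e SLOT BY PROOF» (RULE E-R21 (c) + B-R26 (a″); VERDICT L2187: THEOREM ×1 (B-g42)): the (1 | ρ) moving-zero storey HYPOTHESIS-FREE and one exponential order lower — `∀ ρ, LiouvilleOrder 7 ρ → 4 ≤ polarDeg (1, ρ)` and every (1|ρ) cell / member / 1K-link instance of FactDischarge01 + MovingZero02 §4 UNCONDITIONAL (record: order 8 mod hX) — the slot `ExpOneAlgApprox C` (an approximation measure for e with the degree binder n ≤ Y) filled BY PROOF from the Literature theorem NW96 Thm 4 (2), new separating member T₈ = towerNumber 8 — continuation (RootDecomp1BMovingZeroFree02): §2 budget + engine (order 7)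

(lens-4 g42 HOME kernel MovingZeroFree.lean 1a475554…, 622 l, imports tree RootDecomp1BFactDischarge01 + Literature ExpOneTranscendenceMeasureProofs; CLAIM L2168, ACK/RULING/CHECKLIST B-g42 L2169, NODE L2183 / REQUEST L2184 / RESULT L2185, writer re-check L2186, critic VERDICT L2187 (CLEARED — THEOREM ×1 (B-g42); RULE B-R28; PORT GO 01–05 along K's § boundaries, `--supports stmt-Schanuel-24622`); port by census-1 gen 18 as `RootDecomp1BMovingZeroFree01`–`05`: 01 = §1 the slot `ExpOneAlgApprox` + its two suppliers (record hX, and BY PROOF from NW96 Thm 4(2)); 02 = §2 the budget and the engine one order lower (slot + `LiouvilleOrder 7` + moving zero ⟹ t ≥ 4); 03 = §3 the cells HYPOTHESIS-FREE; 04 = §4 members binder-free + the separating member `T₈ = towerNumber 8`; 05 = §5 the record recovered as an instance.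
PORT EDITS: the slot def's docstring tagged «[slot] definition with parameter; suppliers …» per the verdict (census convention); no `set_option` in K; three tree-twin helpers made `private` after the dedup bounce of 01 (p830609: `irreducible_map_rat_of_irreducible` ≡ Literature NW1996, `nesterenkoWaldschmidt1996_thm_4_2_inScope` ≡ `NesterenkoWaldschmidt1996_thm_4_2_holds`, `one_lt_log_sixteen` ≡ Literature Waldschmidt1978) with per-part private copies; likewise `log_le_log_add_div_sub_one` (≡ Literature Fourier SlitStrip, bounce p830636) and `one_le_log_add_one`; statements and proofs verbatim. `--supports stmt-Schanuel-24622`; no census credit carried; rung 0 — nothing here proves Schanuel.)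
-/

noncomputable section

open Complex Polynomial

namespace Summit.Schanuel.Schanuel.Theorems.RootDecomp1BMovingZeroFree

open Summit.Schanuel.Schanuel.Theorems.RootDecomp1KHyper (LWMeasure)
open Summit.Schanuel.Schanuel.Theorems.RootDecomp1KHyper.HyperCell (log_sixteen_lt_three HyperLiouville lambdaH
  hyperLiouville_lambdaH ExplicitRatExpApprox C₀rat)
open Summit.Schanuel.Schanuel.Theorems.RootDecomp1KGeneric (LiouvilleOrder)
open Summit.Schanuel.Schanuel.Theorems.RootDecomp1KFiniteOrderCell (towerNumber liouvilleOrder_towerNumber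
  not_hyperLiouville_towerNumber towerNumber_sub_rat_lower liouville_towerNumber not_liouvilleOrder_towerNumber)
open Summit.Schanuel.Schanuel.Theorems.RootDecomp1BFedFlagCore (polarDeg polarField)
open Summit.Schanuel.Schanuel.Theorems.RootDecomp1BDefectFloorDefs (SharpRelativeLindemannAt TameDefectZeroAt
  WildSharpDefectZeroAt WildSharpDefectZeroInitAt)
open Summit.Schanuel.Schanuel.Theorems.RootDecomp1BRadicalDescent (UltraLiouville linearIndependent_one_of_irrational)
open Summit.Schanuel.Schanuel.Theorems.RootDecomp1BMovingZero (triple MovingZeroApprox algebraicIndependent_triple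
  isAlgebraic_pair_of_lt_four mem_polarField_one mem_polarField_swap factor_le four_le_polarDeg_of_movingZero
  liouvilleOrder_rhoT not_hyperLiouville_rhoT not_ultraLiouville_rhoT)
open Summit.Schanuel.Schanuel.Theorems.RootDecomp1BFactDischarge (lwMeasure_holds movingZeroApprox_holds)
open Literature.NumberTheory.Transcendental (NesterenkoWaldschmidt1996_thm_4_2 NesterenkoWaldschmidt1996_thm_4_2_holds)
open Literature.NumberTheory.Transcendental.NW1996 (approx_measure_exp_one)

/-! ## §2  The engine, one order lower: slot + `LiouvilleOrder 7` + moving zero ⟹ `t(r) ≥ 4` -/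

/-- `1 ≤ log (q + 1)` for `q ≥ 2` (`e < 3`). -/
private theorem one_le_log_add_one {q : ℝ} (hq : 2 ≤ q) : 1 ≤ Real.log (q + 1) := by
  rw [Real.le_log_iff_exp_le (by linarith)]
  have := Real.exp_one_lt_d9
  linarith

/-- The T-trick: `log x ≤ log T + x / T − 1` for `x, T > 0` (`log (x/T) ≤ x/T − 1`). -/
private theorem log_le_log_add_div_sub_one {x T : ℝ} (hx : 0 < x) (hT : 0 < T) :
    Real.log x ≤ Real.log T + x / T - 1 := by
  have h1 : Real.log (x / T) ≤ x / T - 1 := Real.log_le_sub_one_of_pos (by positivity)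
  have h2 : Real.log x = Real.log T + Real.log (x / T) := by
    rw [Real.log_div hx.ne' hT.ne']; ring
  rw [h2]; linarith

/-- **THE BUDGET (named inequality; the numeral 7).**  Beyond the EXPLICIT threshold
`q > q₀(K, κ, L) := 2 · (K · log T + κ + L) / κ`, `T := 2K/κ + 1` (`K ≥ 0`, `κ > 0`, `L` arbitrary, `q ≥ 2`),
the order-7 gain `κ q⁷` beats the measure's exponent `K q⁶ log(q+1)` plus the constant's slack `L q⁶`:
`K q⁶ log(q+1) + L q⁶ < κ q⁷`.  Proof: the T-trick `log(q+1) ≤ log T + (q+1)/T − 1`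
(`log_le_log_add_div_sub_one`) gives `K log(q+1) ≤ K log T + (κ/2)(q+1)`, whence
`LHS ≤ q⁶ · (K log T + κ + L) + (κ/2) q⁷ < (κ/2) q⁷ + (κ/2) q⁷`. -/
theorem budget_lt {K κ L q : ℝ} (hK : 0 ≤ K) (hκ : 0 < κ) (hq : 2 ≤ q)
    (hqN : 2 * (K * Real.log (2 * K / κ + 1) + κ + L) / κ < q) :
    K * q ^ 6 * Real.log (q + 1) + L * q ^ 6 < κ * q ^ 7 := by
  obtain ⟨T, hT⟩ : ∃ T : ℝ, T = 2 * K / κ + 1 := ⟨_, rfl⟩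
  rw [← hT] at hqN
  have hKκ : 0 ≤ 2 * K / κ := by positivity
  have hT1 : 1 ≤ T := by rw [hT]; linarith
  have hT0 : 0 < T := by linarith
  have hlogT0 : 0 ≤ Real.log T := Real.log_nonneg hT1
  have hKT : K ≤ κ / 2 * T := by
    have h1 : κ / 2 * T = K + κ / 2 := by
      rw [hT]; field_simp
    linarith
  obtain ⟨B, hB⟩ : ∃ B : ℝ, B = K * Real.log T + κ + L := ⟨_, rfl⟩
  rw [← hB] at hqN
  have hq0 : 0 < q := by linarith
  have hq60 : (0 : ℝ) ≤ q ^ 6 := by positivity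
  have hq6pos : (0 : ℝ) < q ^ 6 := by positivity
  -- the T-trick
  have hℓqT : Real.log (q + 1) ≤ Real.log T + (q + 1) / T - 1 :=
    log_le_log_add_div_sub_one (by linarith) hT0
  have hKℓ : K * Real.log (q + 1) ≤ K * Real.log T + κ / 2 * (q + 1) := by
    have h1 : K * Real.log (q + 1) ≤ K * (Real.log T + (q + 1) / T - 1) := mul_le_mul_of_nonneg_left hℓqT hK
    have h2 : K * ((q + 1) / T) ≤ κ / 2 * (q + 1) := by
      rw [mul_div_assoc', div_le_iff₀ hT0]
      calc K * (q + 1) ≤ κ / 2 * T * (q + 1) := mul_le_mul_of_nonneg_right hKT (by linarith)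
        _ = κ / 2 * (q + 1) * T := by ring
    have h3 : K * (Real.log T + (q + 1) / T - 1) = K * Real.log T + K * ((q + 1) / T) - K := by ring
    linarith only [h1, h2, h3, hK]
  -- `LHS ≤ q⁶ B + (κ/2) q⁷`
  have hstep : K * q ^ 6 * Real.log (q + 1) + L * q ^ 6 ≤ q ^ 6 * B + κ / 2 * q ^ 7 := by
    have h1 := mul_le_mul_of_nonneg_left hKℓ hq60
    have e1 : q ^ 6 * (K * Real.log (q + 1)) = K * q ^ 6 * Real.log (q + 1) := by ring
    have e2 : q ^ 6 * (K * Real.log T + κ / 2 * (q + 1)) =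
        q ^ 6 * (K * Real.log T) + κ / 2 * q ^ 7 + κ / 2 * q ^ 6 := by ring
    have e3 : q ^ 6 * B = q ^ 6 * (K * Real.log T) + κ * q ^ 6 + L * q ^ 6 := by rw [hB]; ring
    have h4 : κ / 2 * q ^ 6 ≤ κ * q ^ 6 := mul_le_mul_of_nonneg_right (by linarith) hq60
    linarith only [h1, e1, e2, e3, h4]
  -- `q > 2B/κ` gives `q⁶ B < (κ/2) q⁷`
  have hκq : 2 * B < κ * q := by
    have := (div_lt_iff₀ hκ).1 hqN; linarith
  have hfin' : q ^ 6 * B < κ / 2 * q ^ 7 := by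
    have h1 : q ^ 6 * B < q ^ 6 * (κ * q / 2) := mul_lt_mul_of_pos_left (by linarith) hq6pos
    calc q ^ 6 * B < q ^ 6 * (κ * q / 2) := h1
      _ = κ / 2 * q ^ 7 := by ring
  have e4 : κ / 2 * q ^ 7 + κ / 2 * q ^ 7 = κ * q ^ 7 := by ring
  linarith only [hstep, hfin', e4]

/-- **THE ENGINE (general polar field), ORDER 7.**  For `ρ` of exponential Liouville order `7` with the
moving-zero piece, every real tuple `r` whose polar field contains `ρ, e, e^i, e^ρ, e^{iρ}` has `t(r) ≥ 4`
— mod `hLW` and ANY filling `hE : ExpOneAlgApprox Cₑ` of the level-`e` slot.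
ORDER BOOKKEEPING (the numeral 7): the slot's exponent is `Cₑ n² Y` with `n ≤ c₁′q²` and
`Y = (c₁′ + c₂′) q² log(q+1)` (`≥ n`, `≥ log M(Q)`, `≥ log 16` for `q ≥ 2`), so the exponent is
`≤ K q⁶ log(q+1)`, `K = Cₑ c₁′² (c₁′ + c₂′)`; against `κ q⁷` from the order-7 approximant:
`κ q⁷ < K q⁶ log(q+1) + |log C| q⁶` — contradicting THE BUDGET `budget_lt` (with `L = |log C|`) as soon as
`q > q₀(K, κ, |log C|)`.  WHERE `n ≤ Y` ENTERS: at the single call of the slot `hE` (hypothesis `hnY`). -/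
theorem four_le_polarDeg_of_slot (hLW : LWMeasure) {Cₑ : ℝ} (hCₑ : 0 ≤ Cₑ) (hE : ExpOneAlgApprox Cₑ) {ρ : ℝ}
    (hρ : LiouvilleOrder 7 ρ) (hMZ : MovingZeroApprox ρ) {m : ℕ} {r : Fin m → ℝ}
    (hρr : (ρ : ℂ) ∈ polarField r) (he : cexp 1 ∈ polarField r) (hei : cexp Complex.I ∈ polarField r)
    (heρ : cexp ρ ∈ polarField r) (heρi : cexp (ρ * Complex.I) ∈ polarField r) :
    ((2 + 2 : ℕ) : Cardinal) ≤ polarDeg r := by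
  have h3 : AlgebraicIndependent ℚ (triple ρ) := algebraicIndependent_triple hLW (hρ.liouville (by norm_num))
  by_contra h4
  obtain ⟨halg₁, halg₂⟩ := isAlgebraic_pair_of_lt_four h3 hρr he hei heρ heρi h4
  obtain ⟨C, κ, hC, hκ, c₁, c₂, q₀, hmain⟩ := hMZ h3 halg₁ halg₂
  -- positive majorants of the existential constants (opaque names with defining equations)
  obtain ⟨c₁', hc₁'⟩ : ∃ c : ℝ, c = max c₁ 1 := ⟨_, rfl⟩
  obtain ⟨c₂', hc₂'⟩ : ∃ c : ℝ, c = max c₂ 1 := ⟨_, rfl⟩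
  have hc₁'1 : 1 ≤ c₁' := hc₁' ▸ le_max_right _ _
  have hc₂'1 : 1 ≤ c₂' := hc₂' ▸ le_max_right _ _
  have hc₁c : c₁ ≤ c₁' := hc₁' ▸ le_max_left _ _
  have hc₂c : c₂ ≤ c₂' := hc₂' ▸ le_max_left _ _
  have hc₁'0 : 0 < c₁' := lt_of_lt_of_le one_pos hc₁'1
  have hc₂'0 : 0 < c₂' := lt_of_lt_of_le one_pos hc₂'1
  -- the constant of the clash
  obtain ⟨K, hK⟩ : ∃ K : ℝ, K = Cₑ * c₁' ^ 2 * (c₁' + c₂') := ⟨_, rfl⟩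
  have hK0 : 0 ≤ K := by rw [hK]; positivity
  -- the EXPLICIT threshold `q₀(K, κ, |log C|)` of THE BUDGET `budget_lt`
  obtain ⟨N₁, hN₁⟩ := exists_nat_gt (2 * (K * Real.log (2 * K / κ + 1) + κ + |Real.log C|) / κ)
  obtain ⟨r', hden, _hne, hlt⟩ := hρ (max q₀ (max N₁ 2))
  have hq2n : 2 ≤ r'.den := le_trans ((le_max_right _ _).trans (le_max_right q₀ _)) hden
  have hq2 : (2 : ℝ) ≤ r'.den := by exact_mod_cast hq2n
  have hq1 : (1 : ℝ) ≤ r'.den := by linarith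
  have hq0 : (0 : ℝ) < r'.den := by linarith
  have hqq₀ : q₀ ≤ r'.den := le_trans (le_max_left _ _) hden
  have hqN₁ : (N₁ : ℝ) ≤ r'.den := by
    exact_mod_cast le_trans ((le_max_left _ _).trans (le_max_right q₀ _)) hden
  -- the approximant is in the piece's regime: `exp(−q⁷) ≤ exp(−q)`
  have hq7 : (r'.den : ℝ) ≤ (r'.den : ℝ) ^ 7 := le_self_pow₀ hq1 (by norm_num)
  have hlt' : |ρ - r'| < Real.exp (-(r'.den : ℝ)) :=
    hlt.trans_le (Real.exp_le_exp.2 (by linarith))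
  obtain ⟨Q, ξ, hQirr, hQdeg, hξ, hdeg, hM, hclose⟩ := hmain r' hqq₀ hlt'
  -- sizes of the moving zero: `1 ≤ n ≤ c₁' q²`, `log M ≤ c₂' q² log(q+1)`
  have hdeg' : (Q.natDegree : ℝ) ≤ c₁' * (r'.den : ℝ) ^ 2 :=
    hdeg.trans (mul_le_mul_of_nonneg_right hc₁c (by positivity))
  obtain ⟨ℓq, hℓq⟩ : ∃ ℓ : ℝ, ℓ = Real.log ((r'.den : ℝ) + 1) := ⟨_, rfl⟩
  have hℓq1 : 1 ≤ ℓq := hℓq ▸ one_le_log_add_one hq2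
  have hℓq0 : 0 ≤ ℓq := by linarith
  have hM' : Real.log (Q.map (Int.castRingHom ℂ)).mahlerMeasure ≤ c₂' * (r'.den : ℝ) ^ 2 * ℓq := by
    rw [hℓq]
    exact hM.trans (mul_le_mul_of_nonneg_right (mul_le_mul_of_nonneg_right hc₂c (by positivity))
      (Real.log_nonneg (by linarith)))
  -- the height parameter `Y` of the measure (NO `log(q+1) ≤ q` slack)
  obtain ⟨Y, hYdef⟩ : ∃ Y : ℝ, Y = (c₁' + c₂') * (r'.den : ℝ) ^ 2 * ℓq := ⟨_, rfl⟩
  have hq4 : (4 : ℝ) ≤ (r'.den : ℝ) ^ 2 := by nlinarith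
  have hY8 : 8 ≤ Y := by
    have h1 : (2 : ℝ) * 4 ≤ (c₁' + c₂') * (r'.den : ℝ) ^ 2 :=
      mul_le_mul (by linarith) hq4 (by norm_num) (by positivity)
    have h2 : (2 : ℝ) * 4 * 1 ≤ (c₁' + c₂') * (r'.den : ℝ) ^ 2 * ℓq :=
      mul_le_mul h1 hℓq1 (by norm_num) (by positivity)
    rw [hYdef]; linarith
  have hY16 : Real.log 16 ≤ Y := by linarith [log_sixteen_lt_three]
  have hY0 : 0 ≤ Y := by linarith
  have hnY : (Q.natDegree : ℝ) ≤ Y := by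
    have h1 : c₁' * (r'.den : ℝ) ^ 2 ≤ (c₁' + c₂') * (r'.den : ℝ) ^ 2 :=
      mul_le_mul_of_nonneg_right (by linarith) (by positivity)
    have h2 : c₁' * (r'.den : ℝ) ^ 2 * 1 ≤ (c₁' + c₂') * (r'.den : ℝ) ^ 2 * ℓq :=
      mul_le_mul h1 hℓq1 zero_le_one (by positivity)
    rw [hYdef]; linarith
  have hMY : Real.log (Q.map (Int.castRingHom ℂ)).mahlerMeasure ≤ Y := by
    refine hM'.trans ?_
    rw [hYdef]
    exact mul_le_mul_of_nonneg_right (mul_le_mul_of_nonneg_right (by linarith) (by positivity)) hℓq0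
  -- the approximation measure of `e` at the moving zero `ξ` — THE ONLY USE OF THE SLOT; `n ≤ Y` (`hnY`) ENTERS HERE
  have hlow := hE Q hQirr hQdeg ξ hξ Y hY16 hnY hMY
  obtain ⟨A, hA⟩ : ∃ A : ℝ, A = Cₑ * (Q.natDegree : ℝ) ^ 2 * Y := ⟨_, rfl⟩
  rw [← hA] at hlow
  -- budget: `A ≤ K q⁶ log(q+1)`
  have hn2 : (Q.natDegree : ℝ) ^ 2 ≤ (c₁' * (r'.den : ℝ) ^ 2) ^ 2 := pow_le_pow_left₀ (by positivity) hdeg' 2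
  have hAK : A ≤ K * (r'.den : ℝ) ^ 6 * ℓq := by
    have h1 : (Q.natDegree : ℝ) ^ 2 * Y ≤ (c₁' * (r'.den : ℝ) ^ 2) ^ 2 * Y := mul_le_mul_of_nonneg_right hn2 hY0
    calc A = Cₑ * ((Q.natDegree : ℝ) ^ 2 * Y) := by rw [hA]; ring
      _ ≤ Cₑ * ((c₁' * (r'.den : ℝ) ^ 2) ^ 2 * Y) := mul_le_mul_of_nonneg_left h1 hCₑ
      _ = K * (r'.den : ℝ) ^ 6 * ℓq := by rw [hK, hYdef]; ring
  -- the moving zero is too close: `‖e − ξ‖ ≤ C |ρ − r'|^κ < C exp(−κ q⁷)`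
  have hpow : |ρ - r'| ^ κ < Real.exp (-(r'.den : ℝ) ^ 7) ^ κ :=
    Real.rpow_lt_rpow (abs_nonneg _) hlt hκ
  have hexpκ : Real.exp (-(r'.den : ℝ) ^ 7) ^ κ = Real.exp (-(κ * (r'.den : ℝ) ^ 7)) := by
    rw [← Real.exp_mul]; ring_nf
  have hup : ‖cexp 1 - ξ‖ < C * Real.exp (-(κ * (r'.den : ℝ) ^ 7)) := by
    rw [← hexpκ]
    exact hclose.trans_lt (mul_lt_mul_of_pos_left hpow hC)
  -- the clash
  have hchain : Real.exp (-A) < C * Real.exp (-(κ * (r'.den : ℝ) ^ 7)) := hlow.trans_lt hup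
  have hlog := Real.log_lt_log (Real.exp_pos _) hchain
  rw [Real.log_exp, Real.log_mul hC.ne' (Real.exp_pos _).ne', Real.log_exp] at hlog
  have hlogC : Real.log C ≤ |Real.log C| := le_abs_self _
  have hq6 : (1 : ℝ) ≤ (r'.den : ℝ) ^ 6 := one_le_pow₀ hq1
  have hq60 : (0 : ℝ) ≤ (r'.den : ℝ) ^ 6 := by positivity
  -- `κ q⁷ < K q⁶ log(q+1) + |log C| q⁶`
  have h7 : κ * (r'.den : ℝ) ^ 7 < K * (r'.den : ℝ) ^ 6 * ℓq + |Real.log C| * (r'.den : ℝ) ^ 6 := by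
    have h7a : κ * (r'.den : ℝ) ^ 7 < A + Real.log C := by linarith only [hlog]
    have h7b : |Real.log C| ≤ |Real.log C| * (r'.den : ℝ) ^ 6 := le_mul_of_one_le_right (abs_nonneg _) hq6
    linarith only [h7a, h7b, hAK, hlogC]
  -- … contradicting THE BUDGET beyond the explicit threshold (`N₁ ≤ q`)
  have hqN : 2 * (K * Real.log (2 * K / κ + 1) + κ + |Real.log C|) / κ < (r'.den : ℝ) :=
    lt_of_lt_of_le hN₁ hqN₁
  have hbud := budget_lt hK0 hκ hq2 hqN
  rw [← hℓq] at hbud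
  exact absurd h7 (not_lt.2 hbud.le)

end Summit.Schanuel.Schanuel.Theorems.RootDecomp1BMovingZeroFree

end
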